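import Summits.KontsevichZagierPeriods.KontsevichZagierPeriods.Theorems.LinRedNormalFormArrangementNormalFormStubRebaseSimpleZeroNestedDiffCoreA
import Summits.KontsevichZagierPeriods.KontsevichZagierPeriods.Theorems.LinRedNormalFormArrangementNormalFormStubRebaseSimpleZeroNestedDiffWedge

/-!
# Stub `stub_rebaseSimpleZeroTwo`, part `rebaseSimpleZero_nestedDifferent` (crux
`ArrangementNormalForm`, line `janus-bands`) — brick `NestedDiffEdge`

**Type A with the wall as the top section** (the first NON-dominated configuration of the edge
expansion). After the dissection step "cut `tⱼ` at the wall `W` of the expansion of `tᵢ`" the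
lower piece is the clean nest `A(y) < tᵢ < tⱼ < W(y)` whose TOP IS THE WALL: on it
`|R| = W − tᵢ = (W − tⱼ) + (tⱼ − tᵢ) ≥ 2 √((W − tⱼ)(tⱼ − tᵢ))`, so the two pieces of the edge
expansion are dominated by `K/√((W − tⱼ)(tⱼ − tᵢ))` as soon as the base pole and the two
letters keep a positive distance from the piece (REGULAR case), hence converge by the wedge
estimate `RebaseDiff.integrableOn_wedge` (rule 1b with given convergence,
`RebaseDiff.split_of_integrable`); the letter piece has letters of a common slope, the frame piece
is `RebaseDiff.good_frameA`. Normalised form `RebaseDiff.good_coreA_edge`, general slopes by the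
joint shear `RebaseDiff.good_typeA_edge` (registered as `rebaseSimpleZero_nestedDiffAEdge`).

References: M. Kontsevich, D. Zagier, *Periods* (2001), §1.2, rules (1b), (2).
-/

noncomputable section

open Set MeasureTheory MvPolynomial
open Literature.NumberTheory.Transcendental Literature.ModelTheory.ExponentialFields

namespace Summit.KontsevichZagierPeriods.ArrangementNormalForm.JanusBands

namespace RebaseDiff

open SeparatePos RebasePos RebaseZero RebaseNest

variable {m m' : ℕ} {i j : Fin 2}

/-! ### The edge forms as coordinates -/

/-- The linear map `z ↦ (y, −tⱼ, tⱼ − tᵢ)` reading the two edge forms (up to constants). -/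
def edgeLin (i j : Fin 2) : (Fin 3 → ℝ) →ₗ[ℝ] (Fin 3 → ℝ) where
  toFun z := ![yv (k := 2) z, -tv (k := 2) z j, tv (k := 2) z j - tv (k := 2) z i]
  map_add' z w := by
    funext k
    fin_cases k <;> simp [yv, tv] <;> ring
  map_smul' c z := by
    funext k
    fin_cases k <;> simp [yv, tv]
    ring

/-- `edgeLin` in coordinates. -/
theorem edgeLin_apply (z : Fin 3 → ℝ) :
    edgeLin i j z 0 = yv (k := 2) z ∧ edgeLin i j z 1 = -tv (k := 2) z j ∧
      edgeLin i j z 2 = tv (k := 2) z j - tv (k := 2) z i :=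
  ⟨rfl, rfl, rfl⟩

/-- A set-theoretic left inverse of `edgeLin`: `w ↦ (w₀; tᵢ := −w₁ − w₂, tⱼ := −w₁)`. -/
def edgeBack (i j : Fin 2) (w : Fin 3 → ℝ) : Fin 3 → ℝ := fun k =>
  if k = tIdx (k := 2) i then -w 1 - w 2 else if k = tIdx (k := 2) j then -w 1 else w 0

/-- `edgeBack ∘ edgeLin = id`. -/
theorem edgeBack_edgeLin (hij : i ≠ j) (z : Fin 3 → ℝ) : edgeBack i j (edgeLin i j z) = z := by
  obtain ⟨e0, e1, e2⟩ := edgeLin_apply (i := i) (j := j) z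
  funext k
  rcases idx_cases (k := 2) k with rfl | ⟨q, rfl⟩
  · simp only [edgeBack, if_neg (yIdx_ne_tIdx i), if_neg (yIdx_ne_tIdx j)]
    exact e0
  · rcases fin_two_eq_or hij q with rfl | rfl
    · simp [edgeBack, e1, e2, tv]
    · simp [edgeBack, tIdx_injective.ne hij.symm, e1, tv]

/-- `edgeLin` has non-zero determinant. -/
theorem edgeLin_det_ne (hij : i ≠ j) : LinearMap.det (edgeLin i j) ≠ 0 := by
  have hinj : Function.Injective (edgeLin i j) :=
    Function.LeftInverse.injective (g := edgeBack i j) (edgeBack_edgeLin hij)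
  have hu : IsUnit (edgeLin i j) :=
    (LinearMap.isUnit_iff_ker_eq_bot _).2 (LinearMap.ker_eq_bot.2 hinj)
  exact ((LinearMap.isUnit_iff_isUnit_det _).1 hu).ne_zero

/-- AM–GM for the two edge distances. -/
theorem two_sqrt_mul_le {a b : ℝ} (ha : 0 ≤ a) (hb : 0 ≤ b) : 2 * (Real.sqrt a * Real.sqrt b) ≤ a + b := by
  nlinarith [sq_nonneg (Real.sqrt a - Real.sqrt b), Real.sq_sqrt ha, Real.sq_sqrt hb,
    Real.sqrt_nonneg a, Real.sqrt_nonneg b]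

/-- **Convergence at the edge.** On the nest `A < tᵢ < tⱼ < ρ` (constant top) a semialgebraic
function bounded by `K/(ρ − tᵢ)` is absolutely integrable: `ρ − tᵢ ≥ 2√((ρ − tⱼ)(tⱼ − tᵢ))` and the
wedge estimate. -/
theorem integrableOn_edge (hij : i ≠ j) (M : Fin m' → Cf) (A : Cf) (ρ : ℚ) {D : Set (Fin (0 + 1 + 2) → ℝ)}
    (hD : D = gDom 0 2 m' M (nlo i A) (nhi j (mk 0 ρ))) (hbd : Bornology.IsBounded D)
    {φ : (Fin (0 + 1 + 2) → ℝ) → ℝ} (hφ : IsSemialgebraicFunOn ℚ D φ) (K : ℝ)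
    (hK : ∀ z ∈ D, |φ z| ≤ K / ((ρ : ℝ) - tv z i)) : IntegrableOn φ D := by
  have hDm : MeasurableSet D := by rw [hD]; exact IsSemialgebraic.measurableSet_holds (isSemialgebraic_gDom _ _ _ _)
  obtain ⟨Rb, hRb⟩ := hbd.exists_norm_le
  have mD := fun z => mem_nDom hij M A (mk 0 ρ) z
  refine integrableOn_wedge hDm (KZ.aestronglyMeasurable_of_isSemialgebraicFunOn hφ hDm) (edgeLin i j)
    (edgeLin_det_ne hij) (-ρ) 0 (max K 0 / 2) (Rb + Rb + |(ρ : ℝ)|) (fun z hz => ?_) (fun z hz _ _ => ?_)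
  · obtain ⟨e0, e1, e2⟩ := edgeLin_apply (i := i) (j := j) z
    rw [e0, e1, e2]
    have hy : |yv (k := 2) z| ≤ Rb := (norm_le_pi_norm z (yIdx 2)).trans (hRb z hz)
    have hi' : |tv z i| ≤ Rb := (norm_le_pi_norm z (tIdx i)).trans (hRb z hz)
    have hj' : |tv z j| ≤ Rb := (norm_le_pi_norm z (tIdx j)).trans (hRb z hz)
    have hR0 : 0 ≤ Rb := (abs_nonneg _).trans hy
    refine ⟨by linarith [abs_nonneg (ρ : ℝ)], ?_, ?_⟩
    · calc |-tv z j - -(ρ : ℝ)| = |(ρ : ℝ) - tv z j| := by ring_nf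
        _ ≤ |(ρ : ℝ)| + |tv z j| := abs_sub _ _
        _ ≤ Rb + Rb + |(ρ : ℝ)| := by linarith
    · calc |tv z j - tv z i - 0| = |tv z j - tv z i| := by rw [sub_zero]
        _ ≤ |tv z j| + |tv z i| := abs_sub _ _
        _ ≤ Rb + Rb + |(ρ : ℝ)| := by linarith [abs_nonneg (ρ : ℝ)]
  · obtain ⟨e0, e1, e2⟩ := edgeLin_apply (i := i) (j := j) z
    rw [e1, e2, sub_zero, show -tv z j - -(ρ : ℝ) = (ρ : ℝ) - tv z j by ring]
    have hz' := (mD z).1 (hD ▸ hz)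
    obtain ⟨-, -, h2, h3⟩ := hz'
    rw [ev_mk, Rat.cast_zero, zero_mul, zero_add] at h3
    have ha : 0 < (ρ : ℝ) - tv z j := by linarith
    have hb : 0 < tv z j - tv z i := by linarith
    have hs := two_sqrt_mul_le ha.le hb.le
    have hpos : 0 < Real.sqrt ((ρ : ℝ) - tv z j) * Real.sqrt (tv z j - tv z i) :=
      mul_pos (Real.sqrt_pos.2 ha) (Real.sqrt_pos.2 hb)
    rw [abs_of_pos ha, abs_of_pos hb]
    calc |φ z| ≤ K / ((ρ : ℝ) - tv z i) := hK z hz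
      _ ≤ max K 0 / ((ρ : ℝ) - tv z i) := div_le_div_of_nonneg_right (le_max_left _ _) (by linarith)
      _ ≤ max K 0 / (2 * (Real.sqrt ((ρ : ℝ) - tv z j) * Real.sqrt (tv z j - tv z i))) :=
          div_le_div_of_nonneg_left (le_max_right _ _) (by positivity) (by linarith)
      _ = max K 0 / 2 / (Real.sqrt ((ρ : ℝ) - tv z j) * Real.sqrt (tv z j - tv z i)) := by
          rw [div_div]

/-- **Type A with the wall as the top section, normalised form.** A clean nest `A(y) < tᵢ < tⱼ < ρ`
whose constant top `ρ = cᵢ(r)` is the wall of the edge expansion of `tᵢ` to the slope `0` about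
the base pole `r`, with the literal integrand `K/((y − r)(tᵢ − cᵢ(y))(tⱼ − κ))` (`cᵢ` of slope
`λ ≠ 0`, `κ` constant), in the REGULAR case — `|y − r| ≥ m_y`, `|tᵢ − cᵢ(y)| ≥ mᵢ`, `|tⱼ − κ| ≥ mⱼ`
on the domain for positive constants — is good for `GG 0 2 2`: both pieces of the edge expansion
converge by the wedge estimate, the letter piece has constant letters, the frame piece is
`good_frameA`. [Kontsevich–Zagier 2001, §1.2, rules (1b), (2)] -/
theorem good_coreA_edge (s : KZ.IntegralRep (0 + 1 + 2)) (hij : i ≠ j) (M : Fin m' → Cf) (A : Cf)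
    (T : BData) (p : MvPolynomial (Fin 0) ℚ) (a : Fin 2 → Option Cf) (ci cj : Cf)
    (hi : a i = some ci) (hj : a j = some cj) (hcj : cj.1 (Fin.last 0) = 0) (h1 : T.n₁ = 0)
    (hn : T.n₂ = 1) (hlam : ci.1 (Fin.last 0) ≠ 0) (hbd : Bornology.IsBounded s.domain) (ρ : ℚ)
    (hρ : ρ = ci.2 - (0 - ci.1 (Fin.last 0)) * T.ℓ₂.2)
    (hdom : s.domain = gDom 0 2 m' M (nlo i A) (nhi j (mk 0 ρ)))
    (hint : EqOn s.integrand (glitB T p a) s.domain) (my mi mj : ℝ) (hmy : 0 < my) (hmi : 0 < mi) (hmj : 0 < mj)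
    (hregy : ∀ z ∈ s.domain, my ≤ |yv z - T.ℓ₂.2|) (hregi : ∀ z ∈ s.domain, mi ≤ |tv z i - ev ci (yv z)|)
    (hregj : ∀ z ∈ s.domain, mj ≤ |tv z j - ev cj (yv z)|) : Good 2 (KZ.of s) := by
  subst hρ
  set lam : ℚ := ci.1 (Fin.last 0) with hlamdef
  set r : ℚ := T.ℓ₂.2 with hrdef
  set ρ : ℚ := ci.2 - (0 - lam) * r with hρdef
  have hrot : rot ci 0 r = mk 0 ρ := rfl
  have mD := fun z => mem_nDom hij M A (mk 0 ρ) z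
  have hcjv : ∀ y : ℝ, ev cj y = cj.2 := fun y => by rw [ev, hcj, Rat.cast_zero, zero_mul, zero_add]
  have hne : ∀ z ∈ s.domain, tv z i ≠ ev ci (yv z) := fun z hz h => by
    have := hregi z hz; rw [h, sub_self, abs_zero] at this; exact absurd this (not_le.2 hmi)
  have hy : ∀ z ∈ s.domain, yv z ≠ r := fun z hz h => by
    have := hregy z hz; rw [h, sub_self, abs_zero] at this; exact absurd this (not_le.2 hmy)
  have hnej : ∀ z ∈ s.domain, tv z j ≠ ev cj (yv z) := fun z hz h => by
    have := hregj z hz; rw [h, sub_self, abs_zero] at this; exact absurd this (not_le.2 hmj)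
  -- on the domain `tᵢ < tⱼ < ρ`, so the wall `tᵢ = ρ` is the top edge
  have hR : ∀ z ∈ s.domain, tv z i < tv z j ∧ tv z j < ρ := fun z hz => by
    obtain ⟨-, -, h2, h3⟩ := (mD z).1 (hdom ▸ hz)
    rw [ev_mk, Rat.cast_zero, zero_mul, zero_add] at h3
    exact ⟨h2, h3⟩
  have hRv : ∀ z, tv z i - ev (rot ci 0 r) (yv z) = tv z i - ρ := fun z => by
    rw [hrot, ev_mk, Rat.cast_zero, zero_mul, zero_add]
  have hsa := s.isSemialgebraic_domain
  -- the literal integrand and the two pieces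
  have hlit : ∀ z ∈ s.domain, s.integrand z = Kc T p * (1 / (yv z - r)) *
      ((1 / (tv z i - ev ci (yv z))) * (1 / (tv z j - cj.2))) := fun z hz => by
    rw [hint hz, glitB_two T p a hij ci cj hi hj h1 hn, hcjv]
  -- absolute values of the factors on the domain
  have hf_abs : ∀ z ∈ s.domain, |s.integrand z| = |Kc T p| * (1 / |yv z - r|) *
      ((1 / |tv z i - ev ci (yv z)|) * (1 / |tv z j - cj.2|)) := fun z hz => by
    rw [hlit z hz]; simp only [abs_mul, abs_div, abs_one]
  have hρi : ∀ z ∈ s.domain, 0 < (ρ : ℝ) - tv z i := fun z hz => by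
    have h3 := hR z hz; linarith [h3.1, h3.2]
  have hL_abs : ∀ z ∈ s.domain, |facL i ci 0 r z| = |tv z i - ev ci (yv z)| / ((ρ : ℝ) - tv z i) := fun z hz => by
    rw [facL, hRv, abs_div, abs_sub_comm (tv z i) (ρ : ℝ), abs_of_pos (hρi z hz)]
  have hF_abs : ∀ z ∈ s.domain, |facF i ci 0 r z| = |(lam : ℝ)| * |yv z - r| / ((ρ : ℝ) - tv z i) := fun z hz => by
    rw [facF, hRv, ← hlamdef, abs_div, abs_neg, abs_mul, abs_sub_comm (tv z i) (ρ : ℝ), abs_of_pos (hρi z hz),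
      Rat.cast_sub, Rat.cast_zero, zero_sub, abs_neg]
  have hbj : ∀ z ∈ s.domain, mj ≤ |tv z j - (cj.2 : ℝ)| := fun z hz => by
    have := hregj z hz; rwa [hcjv] at this
  have hI₁ : IntegrableOn (fun z => s.integrand z * facL i ci 0 r z) s.domain := by
    refine integrableOn_edge hij M A ρ hdom hbd (IsSemialgebraicFunOn.mul_holds s.isSemialgebraicFunOn_integrand
      (isSemialgebraicFunOn_facL hsa i ci 0 r)) (|Kc T p| / (my * mj)) fun z hz => ?_
    have hPi : |tv z i - ev ci (yv z)| ≠ 0 := abs_ne_zero.2 (sub_ne_zero.2 (hne z hz))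
    have hρ0 := hρi z hz
    rw [abs_mul, hf_abs z hz, hL_abs z hz]
    calc |Kc T p| * (1 / |yv z - ↑r|) * (1 / |tv z i - ev ci (yv z)| * (1 / |tv z j - ↑cj.2|)) *
          (|tv z i - ev ci (yv z)| / (↑ρ - tv z i))
        = |Kc T p| * (1 / |yv z - ↑r|) * (1 / |tv z j - ↑cj.2|) * (1 / (↑ρ - tv z i)) := by field_simp
      _ ≤ |Kc T p| * (1 / my) * (1 / mj) * (1 / (↑ρ - tv z i)) := by
          gcongr <;> first | exact hregy z hz | exact hbj z hz
      _ = |Kc T p| / (my * mj) / (↑ρ - tv z i) := by field_simp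
  have hI₂ : IntegrableOn (fun z => s.integrand z * facF i ci 0 r z) s.domain := by
    refine integrableOn_edge hij M A ρ hdom hbd (IsSemialgebraicFunOn.mul_holds s.isSemialgebraicFunOn_integrand
      (isSemialgebraicFunOn_facF hsa i ci 0 r)) (|Kc T p| * |(lam : ℝ)| / (mi * mj)) fun z hz => ?_
    have hyr : |yv z - (r : ℝ)| ≠ 0 := abs_ne_zero.2 (sub_ne_zero.2 (hy z hz))
    have hρ0 := hρi z hz
    rw [abs_mul, hf_abs z hz, hF_abs z hz]
    calc |Kc T p| * (1 / |yv z - ↑r|) * (1 / |tv z i - ev ci (yv z)| * (1 / |tv z j - ↑cj.2|)) *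
          (|(lam : ℝ)| * |yv z - ↑r| / (↑ρ - tv z i))
        = |Kc T p| * |(lam : ℝ)| * (1 / |tv z i - ev ci (yv z)|) * (1 / |tv z j - ↑cj.2|) * (1 / (↑ρ - tv z i)) := by
          field_simp
      _ ≤ |Kc T p| * |(lam : ℝ)| * (1 / mi) * (1 / mj) * (1 / (↑ρ - tv z i)) := by
          gcongr <;> first | exact hregi z hz | exact hbj z hz
      _ = |Kc T p| * |(lam : ℝ)| / (mi * mj) / (↑ρ - tv z i) := by field_simp
  -- rule (1b) with the convergence just proved
  obtain ⟨s₁, s₂, hd₁, hd₂, hi₁, hi₂, hrel⟩ := split_of_integrable s _ _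
    (IsSemialgebraicFunOn.mul_holds s.isSemialgebraicFunOn_integrand (isSemialgebraicFunOn_facL hsa i ci 0 r))
    (IsSemialgebraicFunOn.mul_holds s.isSemialgebraicFunOn_integrand (isSemialgebraicFunOn_facF hsa i ci 0 r))
    hI₁ hI₂ (fun z hz => by
      have hRz : tv z i - ev (rot ci 0 r) (yv z) ≠ 0 := by
        rw [hRv]; have := hR z hz; exact fun h => by linarith
      show s.integrand z = s.integrand z * facL i ci 0 r z + s.integrand z * facF i ci 0 r z
      rw [← mul_add, facL_add_facF i ci 0 r z hRz, mul_one])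
  refine good_of_rel3 hrel ?_ ?_
  · -- the letter piece: constant letters `ρ, κ`
    refine good_any s₁ M T.L T.e p T.ℓ₁ T.ℓ₂ (Function.update a i (some (rot ci 0 r))) (nlo i A)
      (nhi j (mk 0 ρ)) h1 hn ⟨0, fun l c hc => ?_⟩ (hd₁ ▸ hbd) (hd₁.trans hdom) fun z hz => ?_
    · rcases fin_two_eq_or hij l with rfl | rfl
      · rw [Function.update_self] at hc; cases hc; rfl
      · rw [Function.update_of_ne hij.symm, hj] at hc; cases hc; exact hcj
    · rw [hd₁] at hz
      rw [hi₁]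
      show s.integrand z * facL i ci 0 r z = glitB T p (Function.update a i (some (rot ci 0 r))) z
      rw [hint hz, glitB_update_letter T p a i ci (rot ci 0 r) hi z (hne z hz), facL]
  · -- the frame piece
    exact good_frameA s₂ hij M A ρ T p a ci cj hi hj hcj h1 hn hlam (hd₂ ▸ hbd) (hd₂.trans hdom)
      (fun z hz => by rw [hi₂, Pi.mul_apply, hint (hd₂ ▸ hz)]) (fun z hz => hne z (hd₂ ▸ hz))
      (fun z hz h => by
        have := hR z (hd₂ ▸ hz); rw [← sub_eq_zero, hRv] at h; linarith)
      (fun z hz => hy z (hd₂ ▸ hz))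

/-- **Type A with the wall as the top section, general slopes.** A clean nest `A(y) < tᵢ < tⱼ < B(y)`
with the literal `GS 0 2` integrand (simple base pole `r = ℓ₂`, letters of different slopes) whose
top `B` IS the wall of the edge expansion of `tᵢ` to the slope `λⱼ` about `r` (`B.1 = λⱼ`,
`B.2 = cᵢ.2 − (λⱼ − λᵢ) r`), in the regular case, is good for `GG 0 2 2`: joint shear along `λⱼ`,
then `good_coreA_edge`. [Kontsevich–Zagier 2001, §1.2, rules (1b), (2)] -/
theorem good_typeA_edge (s : KZ.IntegralRep (0 + 1 + 2)) (hij : i ≠ j) (M : Fin m' → Cf) (A Bd : Cf)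
    (L : Fin m → (Fin 0 → ℚ) × ℚ) (e : Fin m → ℕ) (p : MvPolynomial (Fin 0) ℚ) (ℓ₁ ℓ₂ : (Fin 0 → ℚ) × ℚ)
    (n₁ n₂ : ℕ) (a : Fin 2 → Option Cf) (ci cj : Cf) (hi : a i = some ci) (hj : a j = some cj)
    (hB : Bd.1 (Fin.last 0) = cj.1 (Fin.last 0))
    (hB2 : Bd.2 = ci.2 - (cj.1 (Fin.last 0) - ci.1 (Fin.last 0)) * ℓ₂.2) (hΔ : ci.1 (Fin.last 0) ≠ cj.1 (Fin.last 0))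
    (h1 : n₁ = 0) (hn : n₂ = 1) (hbd : Bornology.IsBounded s.domain)
    (hdom : s.domain = gDom 0 2 m' M (nlo i A) (nhi j Bd))
    (hint : EqOn s.integrand (glit 0 2 p L e ℓ₁ ℓ₂ n₁ n₂ a) s.domain) (my mi mj : ℝ) (hmy : 0 < my)
    (hmi : 0 < mi) (hmj : 0 < mj) (hregy : ∀ z ∈ s.domain, my ≤ |yv z - ℓ₂.2|)
    (hregi : ∀ z ∈ s.domain, mi ≤ |tv z i - ev ci (yv z)|) (hregj : ∀ z ∈ s.domain, mj ≤ |tv z j - ev cj (yv z)|) :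
    Good 2 (KZ.of s) := by
  set lam : ℚ := cj.1 (Fin.last 0) with hlamdef
  -- joint shear along `λⱼ`
  obtain ⟨s', hkey, hbd', hdom', hint', hrel⟩ := pull (fun _ : Fin 2 => (1 : ℚ)) (fun _ => lam) (fun _ => 0)
    s M L e p ℓ₁ ℓ₂ n₁ n₂ a (nlo i A) (nhi j Bd) hbd hdom hint (fun _ => one_ne_zero) (hlink_const 1 lam _ _)
  rw [pullLo_shear, pullHi_shear] at hdom'
  have hai' : pullA (fun _ : Fin 2 => (1 : ℚ)) (fun _ => lam) (fun _ => 0) a i = some (pullC 1 lam 0 ci) := by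
    simp only [pullA, hi, Option.map_some]
  have haj' : pullA (fun _ : Fin 2 => (1 : ℚ)) (fun _ => lam) (fun _ => 0) a j = some (pullC 1 lam 0 cj) := by
    simp only [pullA, hj, Option.map_some]
  have hci' : (pullC 1 lam 0 ci).1 (Fin.last 0) = ci.1 (Fin.last 0) - lam := by rw [pullC_fst_last, div_one]
  have hcj' : (pullC 1 lam 0 cj).1 (Fin.last 0) = cj.1 (Fin.last 0) - lam := by rw [pullC_fst_last, div_one]
  have hBd' : pullC 1 lam 0 Bd = mk 0 Bd.2 := by
    rw [pullC_mk, hB, hlamdef, sub_self, zero_div, Prod.snd_zero, sub_zero, div_one]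
  rw [hBd'] at hdom'
  -- transport of the hypotheses through the shear
  have hid : ∀ (l : Fin 2) (c : Cf) (w : Fin (0 + 1 + 2) → ℝ),
      tv (pullInv (fun _ : Fin 2 => (1 : ℚ)) (fun _ => lam) (fun _ => 0) w) l - ev c (yv w) =
        tv w l - ev (pullC 1 lam 0 c) (yv w) := fun l c w => by
    have h := pullInv_fib_sub_affF (fun _ : Fin 2 => (1 : ℚ)) (fun _ => lam) (fun _ => 0)
      (fun _ => one_ne_zero) l c w
    rw [affF_eq, affF_eq, Rat.cast_one, one_mul] at h
    exact h
  have hyv : ∀ w : Fin (0 + 1 + 2) → ℝ,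
      yv (pullInv (fun _ : Fin 2 => (1 : ℚ)) (fun _ => lam) (fun _ => 0) w) = yv w := fun w =>
    pullInv_base _ _ _ w (Fin.last 0)
  refine RebaseZero.good_of_sub_mem hrel (good_coreA_edge s' hij M (pullC 1 lam 0 A) ⟨m, L, e, ℓ₁, ℓ₂, n₁, n₂⟩
    (MvPolynomial.C (pullQ (fun _ : Fin 2 => (1 : ℚ)) a) * p) _ (pullC 1 lam 0 ci) (pullC 1 lam 0 cj)
    hai' haj' (by rw [hcj', hlamdef, sub_self]) h1 hn (by rw [hci']; exact sub_ne_zero.2 hΔ) hbd' Bd.2 ?_ hdom' hint'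
    my mi mj hmy hmi hmj (fun w hw => ?_) (fun w hw => ?_) (fun w hw => ?_))
  · rw [hB2, pullC_mk]
    simp only [mk_fst, mk_snd, Prod.snd_zero, sub_zero, div_one]
    rw [hlamdef]; ring
  · have h := hregy _ ((hkey w).1 hw)
    rwa [hyv] at h
  · have h := hregi _ ((hkey w).1 hw)
    rwa [hyv, hid] at h
  · have h := hregj _ ((hkey w).1 hw)
    rwa [hyv, hid] at h

end RebaseDiff

/-- **Registered brick `rebaseSimpleZero_nestedDiffAEdge` of the part `rebaseSimpleZero_nestedDifferent`
(stub `stub_rebaseSimpleZeroTwo`, line `janus-bands`): type A with the wall as the top section.**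
A clean nest `A(y) < tᵢ < tⱼ < B(y)` (literal `GS 0 2` datum, simple base pole `r = ℓ₂.2`, both
fibres lettered, `λᵢ ≠ λⱼ`) whose outer upper bound `B` IS the wall of the edge expansion of `tᵢ`
(the line of slope `λⱼ` through `(r, cᵢ(r))`: `B.1 = λⱼ`, `B.2 = cᵢ.2 − (λⱼ − λᵢ) r`), in the
REGULAR case (the base pole and both letters at a positive distance from the domain), is congruent
modulo `KZ.relations` to the subgroup generated by `GG 0 2 2` (`RebaseDiff.good_typeA_edge`: the
expansion is NOT dominated; its two pieces converge by the wedge estimate since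
`|R| = B − tᵢ ≥ 2√((B − tⱼ)(tⱼ − tᵢ))`). This is the lower piece of the dissection "cut `tⱼ` at
the wall" of a type-A nest whose wall enters the band. [Kontsevich–Zagier 2001, §1.2] -/
theorem rebaseSimpleZero_nestedDiffAEdge (m m' n₁ n₂ : ℕ) (s : KZ.IntegralRep (0 + 1 + 2)) (M : Fin m' → (Fin (0 + 1) → ℚ) × ℚ) (L : Fin m → (Fin 0 → ℚ) × ℚ) (e : Fin m → ℕ) (p : MvPolynomial (Fin 0) ℚ) (ℓ₁ ℓ₂ : (Fin 0 → ℚ) × ℚ) (a : Fin 2 → Option ((Fin (0 + 1) → ℚ) × ℚ)) (i j : Fin 2) (hij : i ≠ j) (A Bd ci cj : (Fin (0 + 1) → ℚ) × ℚ) (hi : a i = some ci) (hj : a j = some cj) (hB : Bd.1 (Fin.last 0) = cj.1 (Fin.last 0)) (hB2 : Bd.2 = ci.2 - (cj.1 (Fin.last 0) - ci.1 (Fin.last 0)) * ℓ₂.2) (hΔ : ci.1 (Fin.last 0) ≠ cj.1 (Fin.last 0)) (h1 : n₁ = 0) (hn : n₂ = 1) (hbd : Bornology.IsBounded s.domain)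 (hdom : s.domain = SeparatePos.gDom 0 2 m' M (RebaseNest.nlo i A) (RebaseNest.nhi j Bd)) (hint : EqOn s.integrand (RebasePos.glit 0 2 p L e ℓ₁ ℓ₂ n₁ n₂ a) s.domain) (my mi mj : ℝ) (hmy : 0 < my) (hmi : 0 < mi) (hmj : 0 < mj) (hregy : ∀ z ∈ s.domain, my ≤ |RebaseZero.yv z - ℓ₂.2|) (hregi : ∀ z ∈ s.domain, mi ≤ |RebaseZero.tv z i - RebaseZero.ev ci (RebaseZero.yv z)|) (hregj : ∀ z ∈ s.domain, mj ≤ |RebaseZero.tv z j - RebaseZero.ev cj (RebaseZero.yv z)|) : ∃ c ∈ AddSubgroup.closure (SeparatePos.GGset 0 2 2), KZ.of s - c ∈ KZ.relations :=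
  RebaseDiff.good_typeA_edge s hij M A Bd L e p ℓ₁ ℓ₂ n₁ n₂ a ci cj hi hj hB hB2 hΔ h1 hn hbd hdom hint my mi mj hmy hmi hmj hregy hregi hregj

end Summit.KontsevichZagierPeriods.ArrangementNormalForm.JanusBands
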